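import Literature.Barriers.HodgeConjecture.ConjugateVarietiesSerreArithmeticProofs
import Literature.AlgebraicGeometry.Motives.ComplexPointsManifold
import Literature.AlgebraicGeometry.HodgeTheory.TopDegreeClasses
import HarnessLib

/-!
# Serre 1964 for `p = 23`: the fundamental-group hypotheses at a single base point

Companion to `ConjugateVarietiesSerreArithmeticProofs.lean`, whose
`serre1964_of_fundamentalGroup_models` reduces the barrier fact
`Serre1964_conjugateVarieties_notHomeomorphic` (`ConjugateVarieties.lean`) to the GEOMETRIC half
of Serre's note — Serre's smooth projective `V` over a number field `H` and embeddings `φ, ψ`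
with `π₁(V_φ(ℂ), x) ⊇ N ≅ 𝓞 ℚ(ζ₂₃)` and `π₁(V_ψ(ℂ), y) ⊇ N' ≅ 𝔭·𝓞 ℚ(ζ₂₃)` (normal, index `23`,
an element acting as multiplication by `ζ₂₃`) — asked there at EVERY base point `x`, `y`.
Here the hypotheses are weakened to a SINGLE base point each (`…_models_at`), as Serre's
"`π₁(V_φ)`" (no base point) intends: `V_φ(ℂ)` is path connected, so its fundamental groups at
two base points are isomorphic and the structure transports.  Proofs only: no definitions, no
named facts.

* `ComplexPoints.pathConnectedSpace_of_isSmoothProjective` — `X(ℂ)` is path connected for `X`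
  smooth projective over `ℂ`: connected (SGA1 XII Prop. 2.4, the tree's
  `HodgeTheory.connectedSpace_complexPoints`) and locally path connected (a topological
  `2n`-manifold by the algebraic charts of `ComplexPoints.chartedSpace`, Serre GAGA §2), as the
  tree already records for abelian varieties (`AbelianVariety.Points.instPathConnectedSpace`).
* `Serre1964.exists_model_of_mulEquiv` — the shape "`Γ ⊇ ι(A)` normal of index `p`, `γ₀` acting
  through `T`" is invariant under group isomorphisms `Γ ≃* Γ'`.
* `Serre1964.serre1964_of_fundamentalGroup_models_at` — `serre1964_of_fundamentalGroup_models`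
  with `hφ`, `hψ` at one base point `x₀ ∈ V_φ(ℂ)`, `y₀ ∈ V_ψ(ℂ)` (transport along Mathlib's
  `FundamentalGroup.fundamentalGroupMulEquivOfPathConnected`).

## References

* [Serre1964Conjugate] J.-P. Serre, C. R. Acad. Sci. Paris 258 (1964) 4194–4196 (= *Œuvres* II,
  no. 63), nos. 1–2 and Théorème p. 4196.
* [SGA1] A. Grothendieck, SGA 1, Exp. XII Prop. 2.4.
* [SerreGAGA1956] J.-P. Serre, GAGA, Ann. Inst. Fourier 6 (1956), §2 n°5 Prop. 2, n°6.
-/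

noncomputable section

namespace Literature.AlgebraicGeometry.Motives.ComplexPoints

open CategoryTheory AlgebraicGeometry

/-- **`X(ℂ)` is path connected for `X` smooth projective over `ℂ`**: it is connected
(irreducible varieties have connected complex points, SGA1 XII Prop. 2.4; the tree's
`HodgeTheory.connectedSpace_complexPoints`) and locally path connected (a topological
`2n`-manifold, `IsSmoothProjective.chartedSpace`). [cite: SGA1, Exp. XII Prop. 2.4]
[cite: SerreGAGA1956, §2 n°5 Prop. 2 and n°6] -/
theorem pathConnectedSpace_of_isSmoothProjective {n : ℕ} {X : SchemeOver ℂ}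
    (hX : IsSmoothProjective n X) : PathConnectedSpace (ComplexPoints X) := by
  letI := hX.chartedSpace
  haveI : LocallyPathConnectedSpace (ComplexPoints X) :=
    ChartedSpace.locallyPathConnectedSpace (H := EuclideanSpace ℝ (Fin (2 * n)))
      (M := ComplexPoints X)
  haveI := Literature.AlgebraicGeometry.HodgeTheory.connectedSpace_complexPoints hX
  exact pathConnectedSpace_iff_connectedSpace.2 inferInstance

end Literature.AlgebraicGeometry.Motives.ComplexPoints

namespace Literature.Barriers.HodgeConjecture.Serre1964

open Multiplicative NumberField IntermediateField Literature.AlgebraicGeometry.Motives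

/-- **Transport of the distinguished-subgroup structure along a group isomorphism**: if
`Γ ⊇ ι(A)` with `ι` injective, `ι(A)` normal of index `p` and `γ₀` acting on it through
`T : A → A`, then the same holds in any `Γ' ≅ Γ` (with `e ∘ ι` and `e γ₀`). [folklore] -/
theorem exists_model_of_mulEquiv {A Γ Γ' : Type*} [Group A] [Group Γ] [Group Γ'] (T : A → A)
    (p : ℕ) (e : Γ ≃* Γ')
    (h : ∃ (ι : A →* Γ) (γ₀ : Γ), Function.Injective ι ∧ ι.range.Normal ∧ ι.range.index = p ∧
      ∀ a, γ₀ * ι a * γ₀⁻¹ = ι (T a)) :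
    ∃ (ι : A →* Γ') (γ₀ : Γ'), Function.Injective ι ∧ ι.range.Normal ∧ ι.range.index = p ∧
      ∀ a, γ₀ * ι a * γ₀⁻¹ = ι (T a) := by
  obtain ⟨ι, γ₀, hι, hN, hi, hact⟩ := h
  have hrange : (e.toMonoidHom.comp ι).range = ι.range.map e.toMonoidHom :=
    MonoidHom.range_comp e.toMonoidHom ι
  refine ⟨e.toMonoidHom.comp ι, e γ₀, e.injective.comp hι, ?_, ?_, fun a ↦ ?_⟩
  · rw [hrange]
    exact hN.map e.toMonoidHom e.surjective
  · rw [hrange, Subgroup.index_map_of_bijective e.bijective, hi]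
  · simp only [MonoidHom.coe_comp, MulEquiv.coe_toMonoidHom, Function.comp_apply, ← map_mul,
      ← map_inv, hact]

/-- **Serre 1964 ⇒ `Serre1964_conjugateVarieties_notHomeomorphic`, modulo the geometric half, with
the fundamental-group hypotheses at one base point.** As
`serre1964_of_fundamentalGroup_models`, but `hφ` (resp. `hψ`) is required only at a single
point `x₀ ∈ V_φ(ℂ)` (resp. `y₀ ∈ V_ψ(ℂ)`): `V_φ`, `V_ψ` are smooth projective
(`IsSmoothProjective.baseChangeHom_holds`), so `V_φ(ℂ)`, `V_ψ(ℂ)` are path connected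
(`ComplexPoints.pathConnectedSpace_of_isSmoothProjective`) and the structure of `π₁` transports to
every base point (`exists_model_of_mulEquiv` along
`FundamentalGroup.fundamentalGroupMulEquivOfPathConnected`).  These `hφ`, `hψ` are Serre's
"`π₁(V_φ) = π₁(A_φ)·G`, `π₁(A_φ) ≅ S`" and "`π₁(V_ψ) ⊇ π₁(A_ψ) ≅ e_ψ ⊗_D S`" (nos. 1–2) for
`p = 23`. [cite: Serre1964Conjugate, nos. 1–2 and Théorème p. 4196] -/
theorem serre1964_of_fundamentalGroup_models_at {K : Type*} [Field K] [NumberField K]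
    [IsCyclotomicExtension {23} ℚ K] {ζ : K} (hζ : IsPrimitiveRoot ζ 23)
    {ω : K} (hω : ω ^ 2 = ω - 6) (w : 𝓞 ℚ⟮ω⟯) (hw : (w : ℚ⟮ω⟯) = AdjoinSimple.gen ℚ ω)
    {H : Type} [Field H] [NumberField H] {n : ℕ} {V : SchemeOver H}
    (hV : IsSmoothProjective n V) (φ ψ : H →+* ℂ)
    (x₀ : ComplexPoints ((baseChangeHom φ).obj V)) (y₀ : ComplexPoints ((baseChangeHom ψ).obj V))
    (hφ : ∃ (ι : Multiplicative (𝓞 K) →* FundamentalGroup _ x₀) (γ₀ : FundamentalGroup _ x₀),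
        Function.Injective ι ∧ ι.range.Normal ∧ ι.range.index = 23 ∧
          ∀ s : 𝓞 K, γ₀ * ι (ofAdd s) * γ₀⁻¹ = ι (ofAdd (hζ.toInteger * s)))
    (hψ : ∃ (ι' : Multiplicative
          ↥((Ideal.span {(2 : 𝓞 ℚ⟮ω⟯), w}).map (algebraMap (𝓞 ℚ⟮ω⟯) (𝓞 K))) →*
            FundamentalGroup _ y₀) (γ₀' : FundamentalGroup _ y₀),
        Function.Injective ι' ∧ ι'.range.Normal ∧ ι'.range.index = 23 ∧
          ∀ b : ↥((Ideal.span {(2 : 𝓞 ℚ⟮ω⟯), w}).map (algebraMap (𝓞 ℚ⟮ω⟯) (𝓞 K))),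
            γ₀' * ι' (ofAdd b) * γ₀'⁻¹ = ι' (ofAdd (hζ.toInteger • b))) :
    Serre1964_conjugateVarieties_notHomeomorphic := by
  haveI : Nonempty (ComplexPoints ((baseChangeHom φ).obj V)) := ⟨x₀⟩
  haveI : PathConnectedSpace (ComplexPoints ((baseChangeHom φ).obj V)) :=
    ComplexPoints.pathConnectedSpace_of_isSmoothProjective
      (IsSmoothProjective.baseChangeHom_holds φ hV)
  haveI : PathConnectedSpace (ComplexPoints ((baseChangeHom ψ).obj V)) :=
    ComplexPoints.pathConnectedSpace_of_isSmoothProjective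
      (IsSmoothProjective.baseChangeHom_holds ψ hV)
  refine serre1964_of_fundamentalGroup_models hζ hω w hw hV φ ψ (fun x ↦ ?_) (fun y ↦ ?_)
  · exact exists_model_of_mulEquiv (A := Multiplicative (𝓞 K))
      (fun a ↦ ofAdd (hζ.toInteger * a.toAdd)) 23
      (FundamentalGroup.fundamentalGroupMulEquivOfPathConnected x₀ x) hφ
  · exact exists_model_of_mulEquiv
      (A := Multiplicative ↥((Ideal.span {(2 : 𝓞 ℚ⟮ω⟯), w}).map (algebraMap (𝓞 ℚ⟮ω⟯) (𝓞 K))))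
      (fun b ↦ ofAdd (hζ.toInteger • b.toAdd)) 23
      (FundamentalGroup.fundamentalGroupMulEquivOfPathConnected y₀ y) hψ

end Literature.Barriers.HodgeConjecture.Serre1964

end
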